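import Summits.BirchSwinnertonDyer.Rank1Residual.X12.O11.RouteUSevenUnitCase
import Summits.BirchSwinnertonDyer.Rank1Residual.X12.O11.RouteUTheoremU
import Summits.BirchSwinnertonDyer.Rank1Residual.X12.O11.RouteUSevenBinders
import Summits.BirchSwinnertonDyer.Rank1Residual.X12.O11.RouteUSelmerSha
import Summits.BirchSwinnertonDyer.Rank1Residual.X12.CMSevenAwayFromSeven
import HarnessLib

/-!
# O11 at `p = 7`, ROUTE U — the 𝒞₇ corollary: FULL BSD on 𝒞₇ from the two Route-U inputs

HONEST FRAMING (cell `bsd-cm`, run/shared/lean/pub/bsd-cm/, verbatim): the programme isolates, for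
CM elliptic curves over `ℚ` of analytic rank `≤ 1`, classes on which the FULL BSD formula is
reduced — strictly by PUBLISHED theorems entering as named-fact binders — to ONE local problem at
ONE prime, and then TYPES that residual problem. Sequel (seat `bsd-cm-ram`, g2) of
`RouteUSevenUnitCase.lean` (the typed inputs (U-D) `RouteU.SelmerSevenBound`, (U-A)
`RouteU.ShaAnSevenUnit` and `RouteU.bsdp_seven`): composed with the 𝒞₇ assembly
`ClassCSeven.forall_bsdp_iff_bsdp_seven` (p396430) the two inputs give Miller's `BSD(E,p)` at EVERY
prime. For `E = 49a1^{(D)}` with `7 ∤ β₁(D)β₂(D,d'')` both inputs are THEOREM U of the seat's memo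
`HOME/bsd-cm-ram/ROUTE-U.md` (refereed PASS as a theorem schema, REFEREE-SCORE-bsd-cm-ram-ROUTE-U-v1.md;
54 two-engine instances with `|D| ≤ 1500`). THEOREMS ONLY; nothing asserted about any curve.
-/

noncomputable section

open scoped Classical

open NumberField IsDedekindDomain WeierstrassCurve Literature.NumberTheory.EllipticCurves
  Literature.NumberTheory.EllipticCurves.ModularForms
  Literature.NumberTheory.EllipticCurves.Rank1Residual
  Literature.NumberTheory.EllipticCurves.Rank1Residual.Typed

namespace Summit.BirchSwinnertonDyer.Rank1Residual.X12.O11.RouteU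

variable (W : WeierstrassCurve ℚ) [W.IsElliptic] [W.IsGloballyMinimal]

/-- **ROUTE U ⇒ `BSD(E,7)` on 𝒞₇** (`ClassCSeven W`: CM, `d_K = −7`, `r_an = 1`, good ordinary at `2`,
bad primes `≠ 7` split — the pair `(E,7)` is the class's only CM corner,
`ClassCSeven.classX12_seven`). [cite: Miller2011LMS, §1 and Def. 1.1] -/
theorem bsdp_seven_of_classCSeven (hGZK : rank_eq_analyticRank_of_analyticRank_le_one)
    (h : ClassCSeven W) (hD : SelmerSevenBound W) (hA : ShaAnSevenUnit W) : BSDp W 7 := by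
  obtain ⟨q, hq, hv⟩ := hA
  exact bsdp_of_classX12_of_card_selmerGroup_dvd hGZK W 7 (ClassCSeven.classX12_seven h) hq hv hD

/-- **ROUTE U ⇒ FULL BSD on 𝒞₇.** Granted the named published facts of the 𝒞₇ assembly (`hCM`
Burungale–Flach 2024 / Rubin 1991 rank `0`, `hmod` modularity, `hLLT` Li–Liu–Tian 2024 Thm. 1.1 (i),
`hKob` Kobayashi 2013 Cor. 1.4, `hLTYZ` Li–Tian–Yan–Zhu 2025 Thm. 1.1, and GZK `hGZK`): a 𝒞₇ member
with the two Route-U inputs at `7` satisfies Miller's `BSD(E,p)` at EVERY prime `p` — the full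
Birch–Swinnerton-Dyer formula in the cell's currency (`ClassCSeven.forall_bsdp_iff_bsdp_seven`,
p396430, composed with `bsdp_seven_of_classCSeven`). For `49a1^{(D)}` with `7 ∤ β₁(D)β₂(D,d'')` —
e.g. the 54 members with `|D| ≤ 1500` and generator level `0` listed in memo §2 — the inputs are
Theorem U (paper). [cite: KrizLi2019, Thm. 7.1, Rem. 1.21 and §10.3] [cite: Miller2011LMS, Def. 1.1] -/
theorem forall_bsdp_of_classCSeven (hCM : bsdTriple_of_hasCM_of_L_one_ne_zero)
    (hmod : hasEntireLFunction_rat) (hLLT : LiLiuTian2024.thm11_bsdp_of_cm_rank_one)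
    (hKob : Kobayashi2013.cor14_bsdp_of_cm_rank_one)
    (hLTYZ : LiTianYanZhu2025.thm11_bsdp_of_cm_rank_one)
    (hGZK : rank_eq_analyticRank_of_analyticRank_le_one) (h : ClassCSeven W)
    (hD : SelmerSevenBound W) (hA : ShaAnSevenUnit W) (p : ℕ) (hp : p.Prime) : BSDp W p :=
  (ClassCSeven.forall_bsdp_iff_bsdp_seven hCM hmod hLLT hKob hLTYZ h).2
    (bsdp_seven_of_classCSeven W hGZK h hD hA) p hp

/-- … and the typed X12 input at `7`, `Typed.X12.MissingInputAt W 7`, on 𝒞₇. [cite: Miller2011LMS, Def. 1.1] -/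
theorem missingInputAt_seven_of_classCSeven (hGZK : rank_eq_analyticRank_of_analyticRank_le_one)
    (h : ClassCSeven W) (hD : SelmerSevenBound W) (hA : ShaAnSevenUnit W) :
    Typed.X12.MissingInputAt W 7 := fun _ => by
  haveI : Finite W.sha := (hGZK W (by rw [h.2.2.1])).2
  exact missingPPartAt_of_bsdp W 7 (bsdp_seven_of_classCSeven W hGZK h hD hA)

/-- **THEOREM U (typed, T-U5) ⇒ FULL BSD on 𝒞₇.** For a 𝒞₇ member (`ClassCSeven W`), the ROUTE-U
inputs AT `p = 7` of `RouteU.bsdp_of_thm120_of_rem310` — Kriz–Li Thm. 1.20 (`hKL`) and Rem. 3.10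
(`hRem`), Gross–Zagier/Kolyvagin/GZK/modularity, the auxiliary field `K''` (imaginary quadratic,
Heegner hypothesis for `N_W`, `d_{K''} < −4`, `7 ∤ d_{K''}`, embedded `ιp : K'' → ℚ₇`), the
Heegner point `P`, the twin data, the character data `(f, ψ, ω, ε_K)` with `hss`, (1), (3), `hB`,
and the level-`0` coordinate data — give Miller's `BSD(E,p)` at EVERY prime `p` (the 𝒞₇ assembly
`ClassCSeven.forall_bsdp_iff_bsdp_seven`). Relative to T-U5 five binders are DISCHARGED here
(`RouteUSevenBinders`, `RouteUSelmerSha`): `hns` (additive `7`), `h2` (CM ⇒ no split multiplicative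
prime), `hsplit` (from `ιp` and `7 ∤ d_{K''}`), `hμ` (`w_{K''} = 2`), and `hSW` is replaced by
the descent input (U-D) `hD : SelmerSevenBound W` (the SAME input as `bsdp_seven_of_classCSeven`). [cite: KrizLi2019, Thm. 1.20, Rem. 1.21 and §10.3]
[cite: Miller2011LMS, §1 and Def. 1.1] -/
theorem forall_bsdp_of_thm120_of_rem310
    (hKL : KrizLi2019.thm120_padicLogHeegner_unit_of_bernoulli)
    (hRem : KrizLi2019.rem310_padicLogHeegner_integral)
    (hCM : bsdTriple_of_hasCM_of_L_one_ne_zero) (hmod : hasEntireLFunction_rat)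
    (hLLT : LiLiuTian2024.thm11_bsdp_of_cm_rank_one) (hKob : Kobayashi2013.cor14_bsdp_of_cm_rank_one)
    (hLTYZ : LiTianYanZhu2025.thm11_bsdp_of_cm_rank_one)
    (hGZK : rank_eq_analyticRank_of_analyticRank_le_one)
    (hC : ClassCSeven W)
    [NeZero (W.conductorNorm ℤ)] (K : Type) [Field K] [NumberField K]
    [NeZero (NumberField.discr K).natAbs]
    (D : ModularParametrizationData W (W.conductorNorm ℤ))
    (H : HeegnerDatum (W.conductorNorm ℤ) (NumberField.discr K)) (ι : K →+* ℂ) (ιp : K →+* ℚ_[7])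
    (P : (W.baseChange K).toAffine.Point)
    (hGZ : gross_zagier (W.conductorNorm ℤ) W K) (hKo : kolyvagin (W.conductorNorm ℤ) W K)
    (hK : IsImaginaryQuadratic K) (hHN : SatisfiesHeegnerHypothesis (W.conductorNorm ℤ) K)
    (hd4 : NumberField.discr K < -4) (hd7 : ¬ (7 : ℤ) ∣ NumberField.discr K)
    (hP : WeierstrassCurve.Affine.Point.map ι.toRatAlgHom P = heegnerPointComplex D H)
    (hLt : (W.quadraticTwist (NumberField.discr K : ℚ)).entireLFunction 1 ≠ 0)
    (Wd : WeierstrassCurve ℚ) [Wd.IsElliptic] [Wd.IsGloballyMinimal] (Cd : VariableChange ℚ)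
    (hWd : Cd • W.quadraticTwist (NumberField.discr K : ℚ) = Wd)
    (htw : ∃ q : ℚ, Wd.entireLFunction 1 / (Wd.realPeriodRat : ℂ) = (q : ℂ) ∧
      padicValRat 7 q = (padicValNat 7 Wd.shaOrder : ℤ) + padicValNat 7 Wd.tamagawaProduct -
        2 * padicValNat 7 Wd.torsionOrder)
    (htam : padicValNat 7 Wd.tamagawaProduct = padicValNat 7 W.tamagawaProduct)
    (hu : padicValRat 7 (Cd.u : ℚ) = 0)
    (htamW : ¬ 7 ∣ W.tamagawaProduct)
    (hD : SelmerSevenBound W) (hSd : ∀ [Finite Wd.sha], ¬ 7 ∣ Wd.shaOrder)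
    (f : ℕ) [NeZero f] (ψ : DirichletCharacter ℚ_[7] f) (ω : DirichletCharacter ℚ_[7] 7)
    (hψ : ψ.IsPrimitive) (hω : KrizLi2019.IsTeichmullerCharacter ω)
    (hss : ∀ ℓ : ℕ, ℓ.Prime → ¬ (ℓ ∣ 7 * W.conductorNorm ℤ) →
      ‖((W.LFunction ℓ : ℤ) : ℚ_[7]) - (ψ (ℓ : ZMod f) + ψ⁻¹ (ℓ : ZMod f) * ω (ℓ : ZMod 7))‖ < 1)
    (h1a : ψ (7 : ZMod f) ≠ 1) (h1b : KrizLi2019.primVal (KrizLi2019.invMulOmega ψ ω) 7 ≠ 1)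
    (h3 : ∀ ℓ : ℕ, (hℓ : ℓ.Prime) → ℓ ≠ 7 →
      (haveI := Fact.mk hℓ;
        ¬ W.HasGoodReductionAtPrime ℓ ∧ ¬ W.HasMultiplicativeReductionAtPrime ℓ) →
      ψ (ℓ : ZMod f) ≠ 1 ∧ KrizLi2019.primVal (KrizLi2019.invMulOmega ψ ω) ℓ ≠ 1)
    (εK : DirichletCharacter ℚ_[7] (NumberField.discr K).natAbs)
    (hεK : KrizLi2019.IsKroneckerCharacterOf K εK)
    (hB : ¬ (‖KrizLi2019.bernoulliOnePrim (KrizLi2019.bernoulliCharOne ψ εK) *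
        KrizLi2019.bernoulliOnePrim (KrizLi2019.bernoulliCharTwo ψ εK ω)‖ ≤ (7 : ℝ)⁻¹))
    [Finite (AddCommGroup.torsion (W.baseChange K).toAffine.Point)]
    (crd : (W.baseChange K).toAffine.Point →+ ℤ) (g : (W.baseChange K).toAffine.Point)
    (hg : crd g = 1) (hker : ∀ x, crd x = 0 → IsOfFinAddOrder x)
    (hiv : ∀ x : (W.baseChange K).toAffine.Point, 7 • x = 0 → x = 0)
    (hg0 : ‖Castella2018.padicLogOmega W 7 ιp g‖ = 1) (q : ℕ) (hq : q.Prime) :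
    BSDp W q :=
  (ClassCSeven.forall_bsdp_iff_bsdp_seven hCM hmod hLLT hKob hLTYZ hC).2
    (bsdp_of_thm120_of_rem310 hKL hRem W 7 K D H ι ιp P hGZ hKo hGZK hmod hK hHN hP (by norm_num)
      (not_seven_dvd_unitsTorsionOrder hK hd4) hC.2.2.1 hLt Wd Cd hWd htw htam hu htamW
      (fun {_} => not_dvd_shaOrder_of_analyticRank_eq_one hGZK W 7 hC.2.2.1 hD) hSd f ψ
      ω hψ hω hss h1a h1b (not_hasSplitMultiplicativeReductionAtPrime_of_hasCM W hC.1) h3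
      (ncard_primesOver_seven_eq_two_of_ringHom hK hd7 ιp) εK hεK hB
      (nsPointCount_seven_of_cmFieldDiscr_eq W hC.1 hC.2.1) crd g hg hker hiv hg0) q hq

end Summit.BirchSwinnertonDyer.Rank1Residual.X12.O11.RouteU

end
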